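import Literature.NumberTheory.Automorphic.LocalUnitaryGroupCongr
import Literature.NumberTheory.Automorphic.UnitaryGroupSplitPlace
import Literature.NumberTheory.Automorphic.ParabolicInduction
import Literature.NumberTheory.Automorphic.ParabolicIndGLDetCharIrreducible
import Literature.NumberTheory.Automorphic.GLnStandardLeviTwoBlockModel
import Literature.NumberTheory.Automorphic.UnipotentRadicalCompactOpenProofs
import Literature.NumberTheory.Automorphic.ReductiveGroupData
import Literature.NumberTheory.GaloisRepresentations.HeckeCharacter
import HarnessLib

/-!
# The constant term `f ↦ f̄^P` at a place SPLIT in `L`, as a function on `H_v = U(Φ₂)(L⁺_v) × U(Φ₁)(L⁺_v)`, and the split-place transfer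
# candidate `f ↦ τ_v · f̄^P` (Rogawski 1990, §4.13 Lemma 4.13.1)

Topic `NumberTheory/Automorphic`; namespace `Literature.NumberTheory.Automorphic.UnitaryGroup`.  DEFINITIONS WITH BODY +
unfolding lemmas; no named fact, no `sorry`, no instance, no notation.  Cell `pub/hodgecm-mathlib`, typer ask D1 of the F0P3b desk (line
«CMCharIdentityTest», stub `stub_splitTransferIdentity`): the OBJECT `f^P`.
THE PRINT [Rogawski1990, §4.13 p. 64, Lemma 4.13.1 pp. 64–66]: at a split `v`, `G′_v ≃ GL₃(L_w)`, `H_v ≃ GL₂(L_w) × GL₁(L_w) = M`, the Levi of the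
standard parabolic `P = MN` of type `(2,1)`; «`f̄^P(m) = δ_P(m)^{1∕2} ∫_K ∫_N f(k⁻¹ m n k) dn dk`» (`K = GL₃(𝒪_w)`, `vol(K) = 1`, §4.4 p. 44); (a) `f ↦ f̄^P`
is a `Δ_{G∕H}`-transfer, (b) van Dijk `χ_{i_G(ξ)}(f) = ξ(f̄^P)`.
THE TREE: the `GL₃`-side constant term is the INLINE lambda `m ↦ ∫_{K × U} φ (k (m u) k⁻¹) d(κ ⊗ μ_U)` of ★ `GLnConstantTermTestFunctions` ∕ ★
`GLnLeviOrbitalDescent*` ∕ ★ `Rogawski1990.SmoothTransferSplitPlace` §4 (transfer map `φ ↦ (C · μ_w(det m₍₂₎) · ‖det K_m‖^{1∕2}) · (lambda)` on `H_v`,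
`C` an existential Iwasawa constant).  This file NAMES it on the CM carriers with every normalisation explicit:
* (companion ★-to-be `GLnParabolicRootDeltaBoxAd`: `δ_{P_c}^{1∕2}(p) = ‖det K_p‖^{1∕2}`, the bridge between the van Dijk side — normalised by ★
  `rootDeltaChar` inside ★ `Representation.parabolicIndGL` — and the orbital side's weight.)
* §1 `cmSplitEquivTwo`∕`cmSplitEquivOne` (★ `localSplitEquiv` at `Φ₂`, `Φ₁`, side conditions discharged), `cmSplitLeviGL`∕`cmSplitLeviHom : H_v →* M_{(2,1)}`
  (`h ↦ reindexGL finSumFinEquiv (blockDiagGL (e₂ h.1, e₁ h.2))`, the frame of ★ `exists_continuousMulEquiv_prod_standardLeviGL_twoBlock`), the compact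
  open subgroups `cmSplitMaxCompact = e′⁻¹ GL₃(𝒪_w) ≤ G′_v`, `cmSplitLeviCompact ≤ H_v` whose volumes carry «`vol(K) = 1`»; `lastBlockLabel_three_eq`
  (the parabolic of ★ `Rogawski1990.splitMemberGL` IS the `(2,1)` labelling `i ↦ [2 ≤ i]` of the orbital files).
* §2 `splitKUMeasure F` — product of THE Haar measures of `K = GL₃(𝒪)` (`κ(K) = 1`) and of `U_{(2,1)}(F)` (`μ_U(U ∩ K) = 1`).
* §3 **`cmConstantTermSplit L H′ hH′ hH′d v w hw f : H_v → ℂ`** — print's `f̄^P` read on `H_v` (`e′ = localSplitEquiv` for `H′`; the flip `k ↔ k⁻¹` is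
  immaterial, `κ` being inversion invariant).
* §4 **`cmSplitTransfer L H′ hH′ hH′d v w hw μ νH νG f`**, `h ↦ (νG(K′)∕νH(K_H)) · μ_w(det (e₂ h.1)) · f̄^P(h)` — `τ_v · f̄^P` for ARBITRARY Haar `νG`, `νH`
  (both sides of (a) and (b) scale like `νG(K′)` resp. `νH(K_H)`; prefactor `1` at Rogawski's normalisation) = ★ `SmoothTransferSplitPlace`'s map with
  its `∃ C` explicit (★ `GLnLeviQuotientIwasawaConstant`); `integral_mul_cmSplitTransfer` = the `charDist` shape of (b).
NOT here (the consumer's stubs): (a) «`cmSplitTransfer … f` is `IsLocSmooth` and an ★ `IsLocalDeltaTransfer` of `f` at ★ `finExplicitCollection`», (b) van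
Dijk.  HONEST LABEL: HC_CM is proved only modulo the printed citations (2 remaining named inputs hLiu418, h413) until rung 0 closes; this
file is vocabulary and discharges none of them.

## References
* [Rogawski1990] J. D. Rogawski, *Automorphic Representations of Unitary Groups in Three Variables*, Ann. of Math. Stud. 123 (1990), §4.13 p. 64,
  Lemma 4.13.1 (a)(b) pp. 64–66; §4.4 p. 44; §4.9 p. 54.
* [BernsteinZelevinsky1977] I. N. Bernstein, A. V. Zelevinsky, *Induced representations of reductive 𝔭-adic groups I*, Ann. Sci. ÉNS 10 (1977), 1.7, §2.3.
* [Zelevinsky1980] A. V. Zelevinsky, *Induced representations of reductive 𝔭-adic groups II*, Ann. Sci. ÉNS 13 (1980), §1.1.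
-/

set_option autoImplicit false

noncomputable section

open NumberField IsDedekindDomain MeasureTheory MeasureTheory.Measure TopologicalSpace
open Literature.NumberTheory.GaloisRepresentations
open scoped Matrix MatrixGroups NNReal ENNReal

namespace Literature.NumberTheory.Automorphic

namespace UnitaryGroup

section LeviFrame

variable (L : Type) [Field L] [NumberField L] [IsCMField L]
  (v : HeightOneSpectrum (𝓞 ↥(maximalRealSubfield L))) (w : PlacesOver L v) (hw : IsCMField.complexConj L • w.1 ≠ w.1)

/-! ## §1 The Levi frame `H_v → M_{(2,1)} ≤ GL₃(L_w)` at a split place and the two compact open subgroups -/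

omit [NumberField L] [IsCMField L] in
/-- The two spellings of the `(2,1)` block labelling agree: `Zelevinsky1980.lastBlockLabel 3` (`i ↦ [3 ≤ i + 1]`, the parabolic of ★
`Rogawski1990.splitMemberGL`) is `i ↦ [2 ≤ i]` (the labelling of ★ `Rogawski1990.SmoothTransferSplitPlace` and ★ `GLnStandardLeviTwoBlockModel` at
`k = 2, l = 1`) — the bridge between the van Dijk side and the orbital side. [cite: Zelevinsky1980, §1.1, p. 170] -/
theorem lastBlockLabel_three_eq : Zelevinsky1980.lastBlockLabel 3 = fun i : Fin (2 + 1) => decide (2 ≤ (i : ℕ)) := by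
  funext i
  fin_cases i <;> rfl


/-- **`e₂ : U(Φ₂)(L⁺_v) ≃ₜ* GL₂(L_w)`** — ★ `localSplitEquiv` at the quasi-split plane `Φ₂ = antidiag(1,1)`, its side conditions (`Φ₂` hermitian, a unit
at `w`) discharged by ★ `antidiagOne_isHermitian` ∕ ★ `isUnit_antidiagOne_det` (the `e₂` of ★ `Rogawski1990.SmoothTransferSplitPlace` §4, which keeps them as binders).
[cite: Rogawski1990, §4.13 p. 64] -/
def cmSplitEquivTwo :
    (cmDatum L 2 (Matrix.of fun i j : Fin 2 => if i.val + j.val + 1 = 2 then (1 : L) else 0)).Local v ≃ₜ* GL (Fin 2) (w.1.adicCompletion L) :=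
  localSplitEquiv (IsCMField.complexConj L) (Matrix.of fun i j : Fin 2 => if i.val + j.val + 1 = 2 then (1 : L) else 0)
    (IsCMField.complexConj_ne_one L) ((map_cmConjRingHom_eq_map_complexConj L _) ▸ antidiagOne_isHermitian L 2) w hw
    (isUnit_placeForm_of_isUnit_det (isUnit_antidiagOne_det L 2) w.1)

/-- `cmSplitEquivTwo` IS `localSplitEquiv` at `Φ₂` (definitional; for consumers holding the side conditions as binders, by proof irrelevance).
[cite: Rogawski1990, §4.13 p. 64] -/
theorem cmSplitEquivTwo_eq
    (hΦ : ((Matrix.of fun i j : Fin 2 => if i.val + j.val + 1 = 2 then (1 : L) else 0).map (IsCMField.complexConj L))ᵀ =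
      Matrix.of fun i j : Fin 2 => if i.val + j.val + 1 = 2 then (1 : L) else 0)
    (hΦw : IsUnit (placeForm (Matrix.of fun i j : Fin 2 => if i.val + j.val + 1 = 2 then (1 : L) else 0) w.1)) :
    cmSplitEquivTwo L v w hw =
      localSplitEquiv (IsCMField.complexConj L) (Matrix.of fun i j : Fin 2 => if i.val + j.val + 1 = 2 then (1 : L) else 0)
        (IsCMField.complexConj_ne_one L) hΦ w hw hΦw :=
  rfl

/-- **`e₁ : U(Φ₁)(L⁺_v) ≃ₜ* GL₁(L_w)`** — ★ `localSplitEquiv` at `Φ₁ = (1)`, side conditions discharged. [cite: Rogawski1990, §4.13 p. 64] -/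
def cmSplitEquivOne :
    (cmDatum L 1 (Matrix.of fun i j : Fin 1 => if i.val + j.val + 1 = 1 then (1 : L) else 0)).Local v ≃ₜ* GL (Fin 1) (w.1.adicCompletion L) :=
  localSplitEquiv (IsCMField.complexConj L) (Matrix.of fun i j : Fin 1 => if i.val + j.val + 1 = 1 then (1 : L) else 0)
    (IsCMField.complexConj_ne_one L) ((map_cmConjRingHom_eq_map_complexConj L _) ▸ antidiagOne_isHermitian L 1) w hw
    (isUnit_placeForm_of_isUnit_det (isUnit_antidiagOne_det L 1) w.1)

/-- `cmSplitEquivOne` IS `localSplitEquiv` at `Φ₁` (definitional, proof irrelevance). [cite: Rogawski1990, §4.13 p. 64] -/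
theorem cmSplitEquivOne_eq
    (hΦ : ((Matrix.of fun i j : Fin 1 => if i.val + j.val + 1 = 1 then (1 : L) else 0).map (IsCMField.complexConj L))ᵀ =
      Matrix.of fun i j : Fin 1 => if i.val + j.val + 1 = 1 then (1 : L) else 0)
    (hΦw : IsUnit (placeForm (Matrix.of fun i j : Fin 1 => if i.val + j.val + 1 = 1 then (1 : L) else 0) w.1)) :
    cmSplitEquivOne L v w hw =
      localSplitEquiv (IsCMField.complexConj L) (Matrix.of fun i j : Fin 1 => if i.val + j.val + 1 = 1 then (1 : L) else 0)
        (IsCMField.complexConj_ne_one L) hΦ w hw hΦw :=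
  rfl

/-- **`h ↦ diag(e₂ h.1, e₁ h.2) ∈ GL₃(L_w)`**: the two split-place isomorphisms ★ `localSplitEquiv` `U(Φ₂)(L⁺_v) ≃ GL₂(L_w)`,
`U(Φ₁)(L⁺_v) ≃ GL₁(L_w)` followed by the block-diagonal embedding `reindexGL finSumFinEquiv ∘ blockDiagGL` (the `GL₂`-block FIRST, as in the
parabolic `Zelevinsky1980.lastBlockLabel 3` of ★ `Rogawski1990.splitMemberGL`). [cite: Rogawski1990, §4.13 p. 64] -/
def cmSplitLeviGL :
    ((cmDatum L 2 (Matrix.of fun i j : Fin 2 => if i.val + j.val + 1 = 2 then (1 : L) else 0)).Local v ×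
      (cmDatum L 1 (Matrix.of fun i j : Fin 1 => if i.val + j.val + 1 = 1 then (1 : L) else 0)).Local v) →*
      GL (Fin 3) (w.1.adicCompletion L) :=
  ((reindexGL (finSumFinEquiv : Fin 2 ⊕ Fin 1 ≃ Fin 3)).comp blockDiagGL).comp
    (MonoidHom.prodMap
      (cmSplitEquivTwo L v w hw).toMonoidHom
      (cmSplitEquivOne L v w hw).toMonoidHom)

/-- Unfolding: `cmSplitLeviGL h = reindexGL finSumFinEquiv (blockDiagGL (e₂ h.1, e₁ h.2))`. [cite: Rogawski1990, §4.13 p. 64] -/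
theorem cmSplitLeviGL_apply
    (h : (cmDatum L 2 (Matrix.of fun i j : Fin 2 => if i.val + j.val + 1 = 2 then (1 : L) else 0)).Local v ×
      (cmDatum L 1 (Matrix.of fun i j : Fin 1 => if i.val + j.val + 1 = 1 then (1 : L) else 0)).Local v) :
    cmSplitLeviGL L v w hw h =
      reindexGL (finSumFinEquiv : Fin 2 ⊕ Fin 1 ≃ Fin 3) (blockDiagGL
        (cmSplitEquivTwo L v w hw h.1,
        cmSplitEquivOne L v w hw h.2)) :=
  rfl

/-- `cmSplitLeviGL` is continuous. [cite: Rogawski1990, §4.13 p. 64] -/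
theorem continuous_cmSplitLeviGL : Continuous (cmSplitLeviGL L v w hw) :=
  (continuous_reindexGL _).comp (continuous_blockDiagGL.comp
    ((cmSplitEquivTwo L v w hw).continuous.prodMap (cmSplitEquivOne L v w hw).continuous))

/-- The image of `cmSplitLeviGL` lies in the standard Levi subgroup `M_{(2,1)} = standardLeviGL L_w (lastBlockLabel 3)`
(★ `reindexGL_finSumFinEquiv_blockDiagGL_mem_standardLeviGL`). [cite: Rogawski1990, §4.13 p. 64] -/
theorem cmSplitLeviGL_mem_standardLeviGL
    (h : (cmDatum L 2 (Matrix.of fun i j : Fin 2 => if i.val + j.val + 1 = 2 then (1 : L) else 0)).Local v ×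
      (cmDatum L 1 (Matrix.of fun i j : Fin 1 => if i.val + j.val + 1 = 1 then (1 : L) else 0)).Local v) :
    cmSplitLeviGL L v w hw h ∈ standardLeviGL (w.1.adicCompletion L) (Zelevinsky1980.lastBlockLabel 3) := by
  rw [lastBlockLabel_three_eq]
  exact reindexGL_finSumFinEquiv_blockDiagGL_mem_standardLeviGL (k := 2) (l := 1) _

/-- … hence in the standard parabolic `P_{(2,1)}` (★ `standardLeviGL_le`). [cite: Rogawski1990, §4.13 p. 64] -/
theorem cmSplitLeviGL_mem_standardParabolicGL
    (h : (cmDatum L 2 (Matrix.of fun i j : Fin 2 => if i.val + j.val + 1 = 2 then (1 : L) else 0)).Local v ×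
      (cmDatum L 1 (Matrix.of fun i j : Fin 1 => if i.val + j.val + 1 = 1 then (1 : L) else 0)).Local v) :
    cmSplitLeviGL L v w hw h ∈ standardParabolicGL (w.1.adicCompletion L) (Zelevinsky1980.lastBlockLabel 3) :=
  standardLeviGL_le (w.1.adicCompletion L) _ (cmSplitLeviGL_mem_standardLeviGL L v w hw h)

/-- **`cmSplitLeviHom : H_v →* M_{(2,1)}`** — `cmSplitLeviGL` with values in the Levi subgroup (the `j̃ = eM ∘ (e₂ × e₁)` of ★
`Rogawski1990.SmoothTransferSplitPlace` §4, as a definition). [cite: Rogawski1990, §4.13 p. 64] -/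
def cmSplitLeviHom :
    ((cmDatum L 2 (Matrix.of fun i j : Fin 2 => if i.val + j.val + 1 = 2 then (1 : L) else 0)).Local v ×
      (cmDatum L 1 (Matrix.of fun i j : Fin 1 => if i.val + j.val + 1 = 1 then (1 : L) else 0)).Local v) →*
      ↥(standardLeviGL (w.1.adicCompletion L) (Zelevinsky1980.lastBlockLabel 3)) :=
  (cmSplitLeviGL L v w hw).codRestrict _ (cmSplitLeviGL_mem_standardLeviGL L v w hw)

/-- Unfolding: `(cmSplitLeviHom h : GL₃(L_w)) = cmSplitLeviGL h`. [cite: Rogawski1990, §4.13 p. 64] -/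
@[simp] theorem coe_cmSplitLeviHom_apply
    (h : (cmDatum L 2 (Matrix.of fun i j : Fin 2 => if i.val + j.val + 1 = 2 then (1 : L) else 0)).Local v ×
      (cmDatum L 1 (Matrix.of fun i j : Fin 1 => if i.val + j.val + 1 = 1 then (1 : L) else 0)).Local v) :
    ((cmSplitLeviHom L v w hw h : ↥(standardLeviGL (w.1.adicCompletion L) (Zelevinsky1980.lastBlockLabel 3))) :
      GL (Fin 3) (w.1.adicCompletion L)) = cmSplitLeviGL L v w hw h :=
  rfl

/-- `cmSplitLeviHom` is continuous. [cite: Rogawski1990, §4.13 p. 64] -/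
theorem continuous_cmSplitLeviHom : Continuous (cmSplitLeviHom L v w hw) :=
  (continuous_cmSplitLeviGL L v w hw).subtype_mk _

/-- **`K_H ≤ H_v`**: the compact open subgroup `{h | diag(e₂ h.1, e₁ h.2) ∈ GL₃(𝒪_w)}` (`= U(Φ₂)(𝒪) × U(Φ₁)(𝒪)` read at the split place;
its `νH`-volume is the `H`-side normalisation «`vol(K_H) = 1`»). [cite: Rogawski1990, §4.4 p. 44] -/
def cmSplitLeviCompact :
    Subgroup ((cmDatum L 2 (Matrix.of fun i j : Fin 2 => if i.val + j.val + 1 = 2 then (1 : L) else 0)).Local v ×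
      (cmDatum L 1 (Matrix.of fun i j : Fin 1 => if i.val + j.val + 1 = 1 then (1 : L) else 0)).Local v) :=
  (glInt 3 (w.1.adicCompletion L)).comap (cmSplitLeviGL L v w hw)

/-- Membership in `K_H`: `h ∈ K_H ↔ diag(e₂ h.1, e₁ h.2) ∈ GL₃(𝒪_w)`. [cite: Rogawski1990, §4.4 p. 44] -/
theorem mem_cmSplitLeviCompact_iff
    (h : (cmDatum L 2 (Matrix.of fun i j : Fin 2 => if i.val + j.val + 1 = 2 then (1 : L) else 0)).Local v ×
      (cmDatum L 1 (Matrix.of fun i j : Fin 1 => if i.val + j.val + 1 = 1 then (1 : L) else 0)).Local v) :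
    h ∈ cmSplitLeviCompact L v w hw ↔ cmSplitLeviGL L v w hw h ∈ glInt 3 (w.1.adicCompletion L) :=
  Iff.rfl

variable (H' : Matrix (Fin 3) (Fin 3) L) (hH' : (H'.map (cmConjRingHom L))ᵀ = H') (hH'd : IsUnit H'.det)

/-- **`K′ ≤ G′_v`**: the compact open subgroup `e′⁻¹ GL₃(𝒪_w)` of `G′_v = U(H′)(L⁺_v)`, `e′ = localSplitEquiv` (its `νG`-volume is the
`G′`-side normalisation «`vol(K′) = 1`»). [cite: Rogawski1990, §4.4 p. 44] -/
def cmSplitMaxCompact : Subgroup ((cmDatum L 3 H').Local v) :=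
  (glInt 3 (w.1.adicCompletion L)).comap
    (localSplitEquiv (IsCMField.complexConj L) H' (IsCMField.complexConj_ne_one L)
      ((map_cmConjRingHom_eq_map_complexConj L H') ▸ hH') w hw (isUnit_placeForm_of_isUnit_det hH'd w.1)).toMonoidHom

/-- Membership in `K′`: `g ∈ K′ ↔ e′ g ∈ GL₃(𝒪_w)`. [cite: Rogawski1990, §4.4 p. 44] -/
theorem mem_cmSplitMaxCompact_iff (g : (cmDatum L 3 H').Local v) :
    g ∈ cmSplitMaxCompact L v w hw H' hH' hH'd ↔
      localSplitEquiv (IsCMField.complexConj L) H' (IsCMField.complexConj_ne_one L)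
        ((map_cmConjRingHom_eq_map_complexConj L H') ▸ hH') w hw (isUnit_placeForm_of_isUnit_det hH'd w.1) g ∈
        glInt 3 (w.1.adicCompletion L) :=
  Iff.rfl

end LeviFrame

/-! ## §2 The normalised `K × U` measure (`vol(K) = 1`, `vol(U ∩ K) = 1`) -/

section KUMeasure

variable (F : Type) [Field F] [ValuativeRel F] [TopologicalSpace F] [IsNonarchimedeanLocalField F]

/-- `GL₃(𝒪)` as a positive compact of itself (it is a compact open subgroup of `GL₃(F)`, ★ `isCompact_glInt`). [cite: Rogawski1990, §4.4 p. 44] -/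
def glIntPositiveCompacts : PositiveCompacts ↥(glInt 3 F) where
  carrier := Set.univ
  isCompact' := isCompact_iff_isCompact_univ.1 (isCompact_glInt (n := 3) (F := F))
  interior_nonempty' := by simp only [interior_univ, Set.univ_nonempty]

/-- `U ∩ GL₃(𝒪)` as a positive compact of the unipotent radical `U = U_{(2,1)}(F)` (compact: `U` is closed ★ `isClosed_unipotentRadicalGL` and
`GL₃(𝒪)` compact; non-empty interior: `GL₃(𝒪)` is open ★ `isOpen_glInt` and contains `1`). [cite: Rogawski1990, §4.4 p. 44] -/
def unipotentIntPositiveCompacts : PositiveCompacts ↥(unipotentRadicalGL F (Zelevinsky1980.lastBlockLabel 3)) where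
  carrier := ((↑) : ↥(unipotentRadicalGL F (Zelevinsky1980.lastBlockLabel 3)) → GL (Fin 3) F) ⁻¹' (glInt 3 F : Set (GL (Fin 3) F))
  isCompact' :=
    haveI := (GaloisRepresentations.IsNonarchimedeanLocalField.isLocalField F).toT2Space
    (isClosed_unipotentRadicalGL (R := F) (Zelevinsky1980.lastBlockLabel 3)).isClosedEmbedding_subtypeVal.isCompact_preimage
      (isCompact_glInt (n := 3) (F := F))
  interior_nonempty' :=
    ⟨1, ((isOpen_glInt (n := 3) (F := F)).preimage continuous_subtype_val).interior_eq.symm ▸ (glInt 3 F).one_mem⟩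

/-- **The normalised measure on `K × U`**: the product of THE Haar measure of `K = GL₃(𝒪)` with `κ(K) = 1` and THE Haar measure of
`U = U_{(2,1)}(F)` with `μ_U(U ∩ K) = 1` (Mathlib `haarMeasure` on the positive compacts above; Borel structures from the topology of `GL₃(F)`).
[cite: Rogawski1990, §4.4 p. 44] -/
def splitKUMeasure :
    letI : MeasurableSpace (GL (Fin 3) F) := borel _
    Measure (↥(glInt 3 F) × ↥(unipotentRadicalGL F (Zelevinsky1980.lastBlockLabel 3))) :=
  letI : MeasurableSpace (GL (Fin 3) F) := borel _
  haveI : BorelSpace (GL (Fin 3) F) := ⟨rfl⟩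
  (haarMeasure (glIntPositiveCompacts F)).prod (haarMeasure (unipotentIntPositiveCompacts F))

end KUMeasure

/-! ## §3 The constant term `f ↦ f̄^P` on the CM carriers -/

section ConstantTerm

variable (L : Type) [Field L] [NumberField L] [IsCMField L] (H' : Matrix (Fin 3) (Fin 3) L)
  (hH' : (H'.map (cmConjRingHom L))ᵀ = H') (hH'd : IsUnit H'.det)
  (v : HeightOneSpectrum (𝓞 ↥(maximalRealSubfield L))) (w : PlacesOver L v) (hw : IsCMField.complexConj L • w.1 ≠ w.1)

/-- **`f̄^P` — THE NORMALISED CONSTANT TERM of `f : G′_v → ℂ` along the `(2,1)`-parabolic, as a function on `H_v`**: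
`f̄^P(h) = δ_P(m_h)^{1∕2} · ∫_{K × U} f (e′⁻¹ (k (m_h u) k⁻¹)) d(κ ⊗ μ_U)`, `m_h = diag(e₂ h.1, e₁ h.2)` (★ `cmSplitLeviGL`), `e′ = localSplitEquiv` for
`H′`, `δ_P^{1∕2}` = ★ `rootDeltaChar` of `standardParabolicGL L_w (lastBlockLabel 3)`, `κ(K) = μ_U(U ∩ K) = 1` (★ `splitKUMeasure`) — Rogawski's
«`f̄^P(m) = δ_P(m)^{1∕2} ∫_K ∫_N f(k⁻¹ m n k) dn dk`». [cite: Rogawski1990, §4.13 p. 64; Lemma 4.13.1 pp. 64–66] -/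
def cmConstantTermSplit (f : (cmDatum L 3 H').Local v → ℂ) :
    ((cmDatum L 2 (Matrix.of fun i j : Fin 2 => if i.val + j.val + 1 = 2 then (1 : L) else 0)).Local v ×
      (cmDatum L 1 (Matrix.of fun i j : Fin 1 => if i.val + j.val + 1 = 1 then (1 : L) else 0)).Local v) → ℂ :=
  letI : MeasurableSpace (GL (Fin 3) (w.1.adicCompletion L)) := borel _
  fun h =>
    ((rootDeltaChar (standardParabolicGL (w.1.adicCompletion L) (Zelevinsky1980.lastBlockLabel 3))
        ⟨cmSplitLeviGL L v w hw h, cmSplitLeviGL_mem_standardParabolicGL L v w hw h⟩ : ℂˣ) : ℂ) *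
      ∫ q : ↥(glInt 3 (w.1.adicCompletion L)) × ↥(unipotentRadicalGL (w.1.adicCompletion L) (Zelevinsky1980.lastBlockLabel 3)),
        f ((localSplitEquiv (IsCMField.complexConj L) H' (IsCMField.complexConj_ne_one L)
            ((map_cmConjRingHom_eq_map_complexConj L H') ▸ hH') w hw (isUnit_placeForm_of_isUnit_det hH'd w.1)).symm
          ((q.1 : GL (Fin 3) (w.1.adicCompletion L)) * (cmSplitLeviGL L v w hw h * (q.2 : GL (Fin 3) (w.1.adicCompletion L))) *
            (q.1 : GL (Fin 3) (w.1.adicCompletion L))⁻¹))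
        ∂(splitKUMeasure (w.1.adicCompletion L))

/-- Unfolding of `cmConstantTermSplit` (definitional). [cite: Rogawski1990, §4.13 p. 64] -/
theorem cmConstantTermSplit_apply (f : (cmDatum L 3 H').Local v → ℂ)
    (h : (cmDatum L 2 (Matrix.of fun i j : Fin 2 => if i.val + j.val + 1 = 2 then (1 : L) else 0)).Local v ×
      (cmDatum L 1 (Matrix.of fun i j : Fin 1 => if i.val + j.val + 1 = 1 then (1 : L) else 0)).Local v) :
    cmConstantTermSplit L H' hH' hH'd v w hw f h =
      letI : MeasurableSpace (GL (Fin 3) (w.1.adicCompletion L)) := borel _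
      ((rootDeltaChar (standardParabolicGL (w.1.adicCompletion L) (Zelevinsky1980.lastBlockLabel 3))
          ⟨cmSplitLeviGL L v w hw h, cmSplitLeviGL_mem_standardParabolicGL L v w hw h⟩ : ℂˣ) : ℂ) *
        ∫ q : ↥(glInt 3 (w.1.adicCompletion L)) × ↥(unipotentRadicalGL (w.1.adicCompletion L) (Zelevinsky1980.lastBlockLabel 3)),
          f ((localSplitEquiv (IsCMField.complexConj L) H' (IsCMField.complexConj_ne_one L)
              ((map_cmConjRingHom_eq_map_complexConj L H') ▸ hH') w hw (isUnit_placeForm_of_isUnit_det hH'd w.1)).symm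
            ((q.1 : GL (Fin 3) (w.1.adicCompletion L)) * (cmSplitLeviGL L v w hw h * (q.2 : GL (Fin 3) (w.1.adicCompletion L))) *
              (q.1 : GL (Fin 3) (w.1.adicCompletion L))⁻¹))
          ∂(splitKUMeasure (w.1.adicCompletion L)) :=
  rfl

/-- `f̄^P` is linear in `f`: scalars. [cite: Rogawski1990, §4.13 p. 64] -/
theorem cmConstantTermSplit_smul (c : ℂ) (f : (cmDatum L 3 H').Local v → ℂ) :
    cmConstantTermSplit L H' hH' hH'd v w hw (c • f) = c • cmConstantTermSplit L H' hH' hH'd v w hw f := by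
  funext h
  simp only [cmConstantTermSplit_apply, Pi.smul_apply, smul_eq_mul, integral_const_mul]
  ring

/-- `f̄^P` of the zero function is zero. [cite: Rogawski1990, §4.13 p. 64] -/
theorem cmConstantTermSplit_zero :
    cmConstantTermSplit L H' hH' hH'd v w hw 0 = 0 := by
  rw [← zero_smul ℂ (0 : (cmDatum L 3 H').Local v → ℂ), cmConstantTermSplit_smul, zero_smul]

/-! ## §4 The split-place transfer candidate `f ↦ (νG(K′)∕νH(K_H)) · τ_v · f̄^P` -/

/-- **`τ_v · f̄^P`, normalised for arbitrary Haar measures** — the function on `H_v`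
`h ↦ (νG(K′) ∕ νH(K_H)) · μ_w(det (e₂ h.1)) · f̄^P(h)`: Rogawski's `Δ_{G∕H}`-transfer of `f` at a split place (Lemma 4.13.1 (a): `Δ_{G∕H} = τ D_{G∕H}`,
`τ_v(γ_H) = μ_w(det γ_{H,2})`) written for ARBITRARY Haar measures `νG` on `G′_v`, `νH` on `H_v` (orbital integrals and traces computed with
`νG`, `νH` scale like `νG(K′)`, `νH(K_H)`; at Rogawski's `vol(K′) = vol(K_H) = 1` the prefactor is `1`).  This is the transfer map of ★
`Rogawski1990.isLocalDeltaTransferExists_finExplicit_of_split` with its existential Iwasawa constant made explicit.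
[cite: Rogawski1990, §4.13 Lemma 4.13.1 (a)(b) pp. 64–66; §4.9 p. 55] -/
def cmSplitTransfer (μ : HeckeCharacter L)
    [MeasurableSpace ((cmDatum L 2 (Matrix.of fun i j : Fin 2 => if i.val + j.val + 1 = 2 then (1 : L) else 0)).Local v ×
      (cmDatum L 1 (Matrix.of fun i j : Fin 1 => if i.val + j.val + 1 = 1 then (1 : L) else 0)).Local v)]
    [MeasurableSpace ((cmDatum L 3 H').Local v)]
    (νH : Measure ((cmDatum L 2 (Matrix.of fun i j : Fin 2 => if i.val + j.val + 1 = 2 then (1 : L) else 0)).Local v ×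
      (cmDatum L 1 (Matrix.of fun i j : Fin 1 => if i.val + j.val + 1 = 1 then (1 : L) else 0)).Local v))
    (νG : Measure ((cmDatum L 3 H').Local v)) (f : (cmDatum L 3 H').Local v → ℂ) :
    ((cmDatum L 2 (Matrix.of fun i j : Fin 2 => if i.val + j.val + 1 = 2 then (1 : L) else 0)).Local v ×
      (cmDatum L 1 (Matrix.of fun i j : Fin 1 => if i.val + j.val + 1 = 1 then (1 : L) else 0)).Local v) → ℂ :=
  fun h =>
    (((νG (cmSplitMaxCompact L v w hw H' hH' hH'd)).toReal / (νH (cmSplitLeviCompact L v w hw)).toReal : ℝ) : ℂ) *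
      ((μ.localComponent w.1 (Matrix.GeneralLinearGroup.det
          (cmSplitEquivTwo L v w hw h.1)) : ℂˣ) : ℂ) *
      cmConstantTermSplit L H' hH' hH'd v w hw f h

/-- Unfolding of `cmSplitTransfer` (definitional). [cite: Rogawski1990, §4.13 Lemma 4.13.1 pp. 64–66] -/
theorem cmSplitTransfer_apply (μ : HeckeCharacter L)
    [MeasurableSpace ((cmDatum L 2 (Matrix.of fun i j : Fin 2 => if i.val + j.val + 1 = 2 then (1 : L) else 0)).Local v ×
      (cmDatum L 1 (Matrix.of fun i j : Fin 1 => if i.val + j.val + 1 = 1 then (1 : L) else 0)).Local v)]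
    [MeasurableSpace ((cmDatum L 3 H').Local v)]
    (νH : Measure ((cmDatum L 2 (Matrix.of fun i j : Fin 2 => if i.val + j.val + 1 = 2 then (1 : L) else 0)).Local v ×
      (cmDatum L 1 (Matrix.of fun i j : Fin 1 => if i.val + j.val + 1 = 1 then (1 : L) else 0)).Local v))
    (νG : Measure ((cmDatum L 3 H').Local v)) (f : (cmDatum L 3 H').Local v → ℂ)
    (h : (cmDatum L 2 (Matrix.of fun i j : Fin 2 => if i.val + j.val + 1 = 2 then (1 : L) else 0)).Local v ×
      (cmDatum L 1 (Matrix.of fun i j : Fin 1 => if i.val + j.val + 1 = 1 then (1 : L) else 0)).Local v) :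
    cmSplitTransfer L H' hH' hH'd v w hw μ νH νG f h =
      (((νG (cmSplitMaxCompact L v w hw H' hH' hH'd)).toReal / (νH (cmSplitLeviCompact L v w hw)).toReal : ℝ) : ℂ) *
        ((μ.localComponent w.1 (Matrix.GeneralLinearGroup.det
            (cmSplitEquivTwo L v w hw h.1)) : ℂˣ) : ℂ) *
        cmConstantTermSplit L H' hH' hH'd v w hw f h :=
  rfl

/-- `f ↦ τ_v · f̄^P` is linear in `f`: scalars. [cite: Rogawski1990, §4.13 Lemma 4.13.1 pp. 64–66] -/
theorem cmSplitTransfer_smul (μ : HeckeCharacter L)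
    [MeasurableSpace ((cmDatum L 2 (Matrix.of fun i j : Fin 2 => if i.val + j.val + 1 = 2 then (1 : L) else 0)).Local v ×
      (cmDatum L 1 (Matrix.of fun i j : Fin 1 => if i.val + j.val + 1 = 1 then (1 : L) else 0)).Local v)]
    [MeasurableSpace ((cmDatum L 3 H').Local v)]
    (νH : Measure ((cmDatum L 2 (Matrix.of fun i j : Fin 2 => if i.val + j.val + 1 = 2 then (1 : L) else 0)).Local v ×
      (cmDatum L 1 (Matrix.of fun i j : Fin 1 => if i.val + j.val + 1 = 1 then (1 : L) else 0)).Local v))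
    (νG : Measure ((cmDatum L 3 H').Local v)) (c : ℂ) (f : (cmDatum L 3 H').Local v → ℂ) :
    cmSplitTransfer L H' hH' hH'd v w hw μ νH νG (c • f) = c • cmSplitTransfer L H' hH' hH'd v w hw μ νH νG f := by
  funext h
  simp only [cmSplitTransfer_apply, cmConstantTermSplit_smul, Pi.smul_apply, smul_eq_mul]
  ring

/-- At Rogawski's normalisation `νG(K′) = νH(K_H) = 1` the prefactor disappears: `cmSplitTransfer … f h = μ_w(det (e₂ h.1)) · f̄^P(h)`.
[cite: Rogawski1990, §4.4 p. 44; §4.13 Lemma 4.13.1 pp. 64–66] -/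
theorem cmSplitTransfer_apply_of_measure_eq_one (μ : HeckeCharacter L)
    [MeasurableSpace ((cmDatum L 2 (Matrix.of fun i j : Fin 2 => if i.val + j.val + 1 = 2 then (1 : L) else 0)).Local v ×
      (cmDatum L 1 (Matrix.of fun i j : Fin 1 => if i.val + j.val + 1 = 1 then (1 : L) else 0)).Local v)]
    [MeasurableSpace ((cmDatum L 3 H').Local v)]
    (νH : Measure ((cmDatum L 2 (Matrix.of fun i j : Fin 2 => if i.val + j.val + 1 = 2 then (1 : L) else 0)).Local v ×
      (cmDatum L 1 (Matrix.of fun i j : Fin 1 => if i.val + j.val + 1 = 1 then (1 : L) else 0)).Local v))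
    (νG : Measure ((cmDatum L 3 H').Local v)) (hG : νG (cmSplitMaxCompact L v w hw H' hH' hH'd) = 1)
    (hH : νH (cmSplitLeviCompact L v w hw) = 1) (f : (cmDatum L 3 H').Local v → ℂ)
    (h : (cmDatum L 2 (Matrix.of fun i j : Fin 2 => if i.val + j.val + 1 = 2 then (1 : L) else 0)).Local v ×
      (cmDatum L 1 (Matrix.of fun i j : Fin 1 => if i.val + j.val + 1 = 1 then (1 : L) else 0)).Local v) :
    cmSplitTransfer L H' hH' hH'd v w hw μ νH νG f h =
      ((μ.localComponent w.1 (Matrix.GeneralLinearGroup.det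
          (cmSplitEquivTwo L v w hw h.1)) : ℂˣ) : ℂ) *
        cmConstantTermSplit L H' hH' hH'd v w hw f h := by
  rw [cmSplitTransfer_apply, hG, hH, ENNReal.toReal_one, div_one, Complex.ofReal_one, one_mul]

/-- **The `ξ`-distribution of `τ_v · f̄^P`, unfolded** (the shape ★ `Rogawski1990.charDist ξ νH (cmSplitTransfer … f)` takes — `charDist_def` is `rfl`):
`∫_{H_v} ξ(h) · (τ_v f̄^P)(h) dνH = (νG(K′)∕νH(K_H)) · ∫_{H_v} ξ(h) μ_w(det (e₂ h.1)) f̄^P(h) dνH` — the joint at which van Dijk's formula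
`χ_{i_G(ξ̃)}(f) = ξ̃(f̄^P)` (`ξ̃ = ξ ⊗ μ_w ∘ det`) is read. [cite: Rogawski1990, §4.13 Lemma 4.13.1 (b) p. 64; §13.1 Prop. 13.1.4 p. 199] -/
theorem integral_mul_cmSplitTransfer (μ : HeckeCharacter L)
    [MeasurableSpace ((cmDatum L 2 (Matrix.of fun i j : Fin 2 => if i.val + j.val + 1 = 2 then (1 : L) else 0)).Local v ×
      (cmDatum L 1 (Matrix.of fun i j : Fin 1 => if i.val + j.val + 1 = 1 then (1 : L) else 0)).Local v)]
    [MeasurableSpace ((cmDatum L 3 H').Local v)]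
    (νH : Measure ((cmDatum L 2 (Matrix.of fun i j : Fin 2 => if i.val + j.val + 1 = 2 then (1 : L) else 0)).Local v ×
      (cmDatum L 1 (Matrix.of fun i j : Fin 1 => if i.val + j.val + 1 = 1 then (1 : L) else 0)).Local v))
    (νG : Measure ((cmDatum L 3 H').Local v)) (f : (cmDatum L 3 H').Local v → ℂ)
    (ξ : ((cmDatum L 2 (Matrix.of fun i j : Fin 2 => if i.val + j.val + 1 = 2 then (1 : L) else 0)).Local v ×
      (cmDatum L 1 (Matrix.of fun i j : Fin 1 => if i.val + j.val + 1 = 1 then (1 : L) else 0)).Local v) →* ℂˣ) :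
    ∫ h, (ξ h : ℂ) * cmSplitTransfer L H' hH' hH'd v w hw μ νH νG f h ∂νH =
      (((νG (cmSplitMaxCompact L v w hw H' hH' hH'd)).toReal / (νH (cmSplitLeviCompact L v w hw)).toReal : ℝ) : ℂ) *
        ∫ h, (ξ h : ℂ) * (((μ.localComponent w.1 (Matrix.GeneralLinearGroup.det (cmSplitEquivTwo L v w hw h.1)) : ℂˣ) : ℂ) *
          cmConstantTermSplit L H' hH' hH'd v w hw f h) ∂νH := by
  rw [← integral_const_mul]
  refine integral_congr_ae (Filter.Eventually.of_forall fun h => ?_)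
  simp only [cmSplitTransfer_apply]
  ring

end ConstantTerm

end UnitaryGroup

end Literature.NumberTheory.Automorphic

end
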